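import Literature.AlgebraicGeometry.Frobenioids.ArithmeticRealificationInstance
import Literature.AlgebraicGeometry.Frobenioids.ArithmeticRealificationPicCone
import Literature.AlgebraicGeometry.Frobenioids.ArithmeticRealificationPicPull
import Literature.AlgebraicGeometry.Frobenioids.GroupSubfunctorsPicTransport
import Literature.AlgebraicGeometry.Frobenioids.ArithmeticRealificationScaledNaturality
import Literature.AlgebraicGeometry.Frobenioids.FinSubextCatDegreeInvariance
import Literature.AlgebraicGeometry.Frobenioids.MotivatingExamplesSubProofs
import HarnessLib

/-!
# Frobenioids I, Theorem 6.4 (ii) AT THE DATA: the degree `deg(Ψ^rlf) ∈ ℝ_{>0}` of an equivalence of THE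
# realified arithmetic Frobenioids — the schema letter `Thm64ii` closed for `arithRealification hΦ_i`

Mochizuki, *The geometry of Frobenioids I: the general theory*, Kyushu J. Math. **62** (2008) 293–400, §6,
Theorem 6.4 (ii), kurims text p. 114 [cite: MochizukiFrdI2008, Thm. 6.4 (ii) p.114]:

> "(ii) Let `Ψ^rlf : C₁^rlf ⥲ C₂^rlf` be an equivalence of categories. Then there exists an element
> `deg(Ψ^rlf) ∈ ℝ_{>0}` such that for all Frobenius-trivial `A₁ ∈ Ob(C₁)`, `A₂ ∈ Ob(C₂)` such that `A₂ = Ψ^rlf(A₁)`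
> … the composite of `δ_{A₂}` with the isomorphism `Pic_Φ(A₁) ⥲ Pic_Φ(A₂)` induced by `Ψ^rlf` … is equal to
> `deg(Ψ^rlf) · δ_{A₁}`."

Proof p. 115 l. 34 – p. 116 l. 3: "the isomorphism of groups `Pic_Φ(A₁) ⥲ Pic_Φ(A₂)` determined by `Ψ^rlf` [cf. assertion
(i); Corollary 4.10; Corollary 4.11, (iii)] is compatible with the 'order structure' induced on both sides by the 'order
structure' of `ℝ`. [Indeed, this compatibility follows from the fact that the isomorphism in question arises from an
isomorphism of monoids `Φ₁^rlf(A₁) ⥲ Φ₂^rlf(A₂)`.] Thus, assertion (ii) follows immediately."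

PROOF-ONLY file (cell abc-iut, sub-DAG `plan/L1/SUBDAG-FrdI-Thm64.md` rows T64ii/L01–L05 AT THE DATA = L1-lead R114 (2)
«(E) FILE 2»; seat abc-iut-w4-d086; no definitions, no instances, no notation).  THE data: abc-iut-L1-d2's
`arithRealification hΦ_i` (`ArithmeticRealificationInstance.lean`: `C_{K_i/F_i}^rlf`, `Pic_Φ(A) = (Φ^rlf)^gp(Base A) ⧸
(ℝ · Φ^birat)(Base A)`, `δ_A` induced by `deg^arith`).  The equivalence `Ψ : C₁^rlf ⥲ C₂^rlf` enters together with its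
[FrdI] Cor. 4.11 (iii) / Cor. 5.4 data, taken as BINDERS and never asserted: an equivalence `Ψ^Base : D₁ ⥲ D₂` under it
(`η : Base₂ ∘ Ψ ≅ Ψ^Base ∘ Base₁`), an isomorphism of realified divisor monoids `Ψ^Φ : Φ₁^rlf ⥲ Φ₂^rlf` over `Ψ^Base`
(`Erlf : PreFrobenioidData.DivisorMonoidIsoOverBase …`) and the compatibility of `Ψ^Φ` with the real spans `ℝ · Φ_i^birat`
(`hspan`, the conclusion of `FrdI.Cor54Sub.RealSpanCompat` / hypothesis of `FrdI.Cor54Sub.RlfTransport`) — the shape in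
which abc-iut-L1-d7's `exists_rlfTransport_of_cor411iv` (Ψ^rlf arising from `Ψ : C₁ ⥲ C₂`) and the E5 lane (arbitrary `Ψ^rlf`,
[FrdI] Cor. 4.11 (iii) at the realifications) deliver them.  Inputs consumed BY NAME:
* E1 (abc-iut-w4-d086) `GpSubfunctor.exists_pic_mulEquiv_classMap` — the `Pic` isomorphisms `π_X` induced by `Ψ^Φ`,
  `π_X [a] = [Ψ^Φ a]`, natural along pull-backs (T64ii/L01);
* abc-iut-w4-d086 `monotone_of_map_nonneg` + abc-iut-L1-d2's cone `arith_picDegree_nonneg_iff` (T64ii/L02) and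
  abc-iut-L1-t1's `Thm64ii_L03_monotoneAddAut_holds` (T64ii/L03): `δ ∘ π_X ∘ δ⁻¹ = deg_X · id`, `deg_X > 0`;
* E4 (abc-iut-L1-d2) `arith_toAdd_picDegree_picPull` — `δ_X ∘ Pic(f) = [L_X : L_Y] · δ_Y` — and E3 (abc-iut-L1-t12)
  `FinSubextCat.finrank_along_map_eq_of_equivalence` — `[L_{Ψ X} : L_{Ψ Y}] = [L_X : L_Y]` (T64ii/L04): `deg_X = deg_Y` along
  every `f : X → Y`, and every `X` maps to `Spec F₁`, so ONE `deg`.  (The per-pair scaled-transport form of T64ii/L04 —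
  abc-iut-w5-d137's E2 `Thm64ii_L04_uniform_of_scaledNaturality`, abc-iut-L1-d2's `Thm64ii_L04_eq_of_scaledTransport` — is
  the same argument packaged over the schema; here the two scalings are read directly at THE `δ`.)

Results: `ArithRlfPic.exists_pic_transport_deg` (`D`-level: `π`, ONE `deg > 0`, `δ ∘ π_X = deg · δ`);
`ArithFrd.exists_picMap_thm64ii` (THE induced `picMap_A = (η_A)^* ∘ π_{Base A}` satisfies `Thm64ii`; values on classes of
monoid elements and their degrees); **`ArithFrd.thm64ii_at_data`** — the schema letter CLOSED at THE data.
Nothing here is specific to the abc programme or bears on [IUTchIII] Cor. 3.12; no statement of the paper is strengthened.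
-/

noncomputable section

open scoped NNReal

namespace Literature.AlgebraicGeometry.Frobenioids

open CategoryTheory Opposite Function NumberField Literature.AnabelianGeometry.EtaleTheta

/-! ### `Pic(f)` is functorial in `f`; along an isomorphism of the base it is an isomorphism -/

namespace GpSubfunctor

universe w v u

variable {D : Type u} [Category.{v} D] {Φ : Dᵒᵖ ⥤ CommMonCat.{w}} (Ψ : GpSubfunctor Φ)

/-- `Pic(f) [c] = [Φ(f) c]`. [cite: MochizukiFrdI2008, Thm. 5.1 (ii) p.97] -/
theorem picPull_mk {X Y : D} (f : X ⟶ Y) (c : Algebra.GrothendieckGroup (Φ.obj (op Y))) :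
    Ψ.picPull f (QuotientGroup.mk c) = QuotientGroup.mk (pullGp Φ f c) := rfl

/-- `Pic(f ≫ g) = Pic(f) ∘ Pic(g)` (contravariance). [cite: MochizukiFrdI2008, Thm. 5.1 (ii) p.97] -/
theorem picPull_comp_apply {X Y Z : D} (f : X ⟶ Y) (g : Y ⟶ Z) (x : Ψ.Pic Z) :
    Ψ.picPull (f ≫ g) x = Ψ.picPull f (Ψ.picPull g x) := by
  induction x using QuotientGroup.induction_on with
  | H c => simp only [picPull_mk, pullGp_comp]

/-- `Pic(𝟙) = id`. [cite: MochizukiFrdI2008, Thm. 5.1 (ii) p.97] -/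
theorem picPull_id_apply (X : D) (x : Ψ.Pic X) : Ψ.picPull (𝟙 X) x = x := by
  induction x using QuotientGroup.induction_on with
  | H c => simp only [picPull_mk, pullGp_id]

/-- Along an isomorphism `i : X ≅ Y` of the base, `Pic(i.inv) ∘ Pic(i.hom) = id`.
[cite: MochizukiFrdI2008, Thm. 5.1 (ii) p.97] -/
theorem picPull_inv_comp_hom {X Y : D} (i : X ≅ Y) : (Ψ.picPull i.inv).comp (Ψ.picPull i.hom) = MonoidHom.id _ :=
  MonoidHom.ext fun x => by
    rw [MonoidHom.comp_apply, ← picPull_comp_apply, i.inv_hom_id, picPull_id_apply, MonoidHom.id_apply]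

/-- Along an isomorphism `i : X ≅ Y` of the base, `Pic(i.hom) ∘ Pic(i.inv) = id`.
[cite: MochizukiFrdI2008, Thm. 5.1 (ii) p.97] -/
theorem picPull_hom_comp_inv {X Y : D} (i : X ≅ Y) : (Ψ.picPull i.hom).comp (Ψ.picPull i.inv) = MonoidHom.id _ :=
  MonoidHom.ext fun x => by
    rw [MonoidHom.comp_apply, ← picPull_comp_apply, i.hom_inv_id, picPull_id_apply, MonoidHom.id_apply]

end GpSubfunctor

/-! ### THE realified arithmetic Frobenioid: `δ` along pull-backs, the cone -/

namespace ArithRlfPic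

section OneSide

variable {F : Type} [Field F] [NumberField F] {K : Type} [Field K] [Algebra F K]
  (hΦ : PreFrobenioid.IsPerfFactorialOn (arithDivisorFunctor F K))

/-- **`δ_X (Pic(f) y) = [L_X : L_Y] · δ_Y y`** for THE descended degrees `picDegree` (abc-iut-L1-d2's
`arith_toAdd_picDegree_picPull` at THE degree data). [cite: MochizukiFrdI2008, Thm. 6.4 (ii) p.114] -/
theorem toAdd_picDegree_picPull {X Y : FinSubextCat F K} (f : X ⟶ Y)
    (y : ((RealificationData.canonical (arithDivisorFunctor F K) (PreFrobenioid.IsPerfFactorialOn.op hΦ)).realSpan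
        (PreFrobenioid.biratSubfunctor
          (ModelFrobenioid.toElem (arithDivisorFunctor F K) (unitsFunctor F K) (divNatTrans F K)))).Pic Y) :
    Multiplicative.toAdd (picDegree hΦ X (((RealificationData.canonical (arithDivisorFunctor F K)
        (PreFrobenioid.IsPerfFactorialOn.op hΦ)).realSpan (PreFrobenioid.biratSubfunctor
          (ModelFrobenioid.toElem (arithDivisorFunctor F K) (unitsFunctor F K) (divNatTrans F K)))).picPull f y)) =
      (letI := f.toAlgHom.toRingHom.toAlgebra; Module.finrank Y.L X.L) * Multiplicative.toAdd (picDegree hΦ Y y) :=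
  arith_toAdd_picDegree_picPull hΦ f _ (rlfDegree_iota hΦ X) _ (rlfDegree_iota hΦ Y) _ (picDegree_comp_mk' hΦ X) _
    (picDegree_comp_mk' hΦ Y) y

/-- **`δ` is invariant under pull-back along an ISOMORPHISM of the base**: for `i : X ≅ Y` in `D`,
`δ_X (Pic(i.hom) y) = δ_Y y` (the two scaling factors `[L_X : L_Y]`, `[L_Y : L_X]` are natural numbers with
product `1`). [cite: MochizukiFrdI2008, Thm. 6.4 (ii) p.114] -/
theorem toAdd_picDegree_picPull_iso {X Y : FinSubextCat F K} (i : X ≅ Y)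
    (y : ((RealificationData.canonical (arithDivisorFunctor F K) (PreFrobenioid.IsPerfFactorialOn.op hΦ)).realSpan
        (PreFrobenioid.biratSubfunctor
          (ModelFrobenioid.toElem (arithDivisorFunctor F K) (unitsFunctor F K) (divNatTrans F K)))).Pic Y) :
    Multiplicative.toAdd (picDegree hΦ X (((RealificationData.canonical (arithDivisorFunctor F K)
        (PreFrobenioid.IsPerfFactorialOn.op hΦ)).realSpan (PreFrobenioid.biratSubfunctor
          (ModelFrobenioid.toElem (arithDivisorFunctor F K) (unitsFunctor F K) (divNatTrans F K)))).picPull i.hom y)) =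
      Multiplicative.toAdd (picDegree hΦ Y y) := by
  set Pbirat := (RealificationData.canonical (arithDivisorFunctor F K) (PreFrobenioid.IsPerfFactorialOn.op hΦ)).realSpan
    (PreFrobenioid.biratSubfunctor (ModelFrobenioid.toElem (arithDivisorFunctor F K) (unitsFunctor F K) (divNatTrans F K)))
  -- the two natural-number factors
  set n : ℕ := (letI := i.hom.toAlgHom.toRingHom.toAlgebra; Module.finrank Y.L X.L)
  set m : ℕ := (letI := i.inv.toAlgHom.toRingHom.toAlgebra; Module.finrank X.L Y.L)
  have h1 : ∀ z, Multiplicative.toAdd (picDegree hΦ X (Pbirat.picPull i.hom z)) =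
      n * Multiplicative.toAdd (picDegree hΦ Y z) := fun z => toAdd_picDegree_picPull hΦ i.hom z
  have h2 : ∀ z, Multiplicative.toAdd (picDegree hΦ Y (Pbirat.picPull i.inv z)) =
      m * Multiplicative.toAdd (picDegree hΦ X z) := fun z => toAdd_picDegree_picPull hΦ i.inv z
  -- `m * n = 1`: evaluate at a class of degree `1`
  obtain ⟨y₀, hy₀⟩ := (picDegree_bijective hΦ Y).2 (Multiplicative.ofAdd 1)
  have hmn : (m : ℝ) * n = 1 := by
    have h := h2 (Pbirat.picPull i.hom y₀)
    rw [← GpSubfunctor.picPull_comp_apply, i.inv_hom_id, GpSubfunctor.picPull_id_apply, h1, hy₀, toAdd_ofAdd,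
      mul_one] at h
    exact h.symm
  have hn1 : n = 1 := by
    have hmn' : m * n = 1 := by exact_mod_cast hmn
    exact Nat.eq_one_of_mul_eq_one_left hmn'
  rw [h1, hn1, Nat.cast_one, one_mul]

/-- The non-negative cone of `(Pic_Φ(Spec L), δ_L)` IS the set of classes of elements of `Φ(L)^rlf`
(abc-iut-L1-d2's `arith_picDegree_nonneg_iff` at THE degree data). [cite: MochizukiFrdI2008, Thm. 6.4 (ii) p.115] -/
theorem picDegree_nonneg_iff (X : FinSubextCat F K)
    (x : ((RealificationData.canonical (arithDivisorFunctor F K) (PreFrobenioid.IsPerfFactorialOn.op hΦ)).realSpan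
        (PreFrobenioid.biratSubfunctor
          (ModelFrobenioid.toElem (arithDivisorFunctor F K) (unitsFunctor F K) (divNatTrans F K)))).Pic X) :
    0 ≤ Multiplicative.toAdd (picDegree hΦ X x) ↔
      ∃ a : (RealificationData.canonical (arithDivisorFunctor F K) (PreFrobenioid.IsPerfFactorialOn.op hΦ)).rlf.obj
        (op X), x = QuotientGroup.mk' _ (Algebra.GrothendieckGroup.of a) :=
  arith_picDegree_nonneg_iff hΦ X _ (rlfDegree_iota hΦ X) _ (picDegree_comp_mk' hΦ X) x

/-- Classes of elements of `Φ(L)^rlf` have non-negative degree. [cite: MochizukiFrdI2008, Thm. 6.4 (ii) p.115] -/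
theorem picDegree_mk_of_nonneg (X : FinSubextCat F K)
    (a : (RealificationData.canonical (arithDivisorFunctor F K) (PreFrobenioid.IsPerfFactorialOn.op hΦ)).rlf.obj
      (op X)) :
    0 ≤ Multiplicative.toAdd (picDegree hΦ X (QuotientGroup.mk' _ (Algebra.GrothendieckGroup.of a))) :=
  arith_picDegree_mk_of_nonneg hΦ X _ _ (picDegree_comp_mk' hΦ X) a

end OneSide

/-! ### Two sides: the `Pic` transport induced by an isomorphism `Φ₁^rlf ⥲ Φ₂^rlf` over `Ψ^Base`, and its degree -/

section TwoSides

variable {F₁ : Type} [Field F₁] [NumberField F₁] {K₁ : Type} [Field K₁] [Algebra F₁ K₁]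
  {F₂ : Type} [Field F₂] [NumberField F₂] {K₂ : Type} [Field K₂] [Algebra F₂ K₂]
  (hΦ₁ : PreFrobenioid.IsPerfFactorialOn (arithDivisorFunctor F₁ K₁))
  (hΦ₂ : PreFrobenioid.IsPerfFactorialOn (arithDivisorFunctor F₂ K₂))
  (ΨBase : FinSubextCat F₁ K₁ ≌ FinSubextCat F₂ K₂)
  (Erlf : PreFrobenioidData.DivisorMonoidIsoOverBase
    (FrdI.Cor54Sub.rlfData (ModelFrobenioid.toElem (arithDivisorFunctor F₁ K₁) (unitsFunctor F₁ K₁)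
      (divNatTrans F₁ K₁)) hΦ₁)
    (FrdI.Cor54Sub.rlfData (ModelFrobenioid.toElem (arithDivisorFunctor F₂ K₂) (unitsFunctor F₂ K₂)
      (divNatTrans F₂ K₂)) hΦ₂) ΨBase.functor)
  (hspan : ∀ X : FinSubextCat F₁ K₁,
    (((RealificationData.canonical (arithDivisorFunctor F₁ K₁) (PreFrobenioid.IsPerfFactorialOn.op hΦ₁)).realSpan
          (PreFrobenioid.biratSubfunctor (ModelFrobenioid.toElem (arithDivisorFunctor F₁ K₁) (unitsFunctor F₁ K₁)
            (divNatTrans F₁ K₁)))).carrier X).map (MonGp.map (Erlf.iso X).toMonoidHom) =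
      ((RealificationData.canonical (arithDivisorFunctor F₂ K₂) (PreFrobenioid.IsPerfFactorialOn.op hΦ₂)).realSpan
          (PreFrobenioid.biratSubfunctor (ModelFrobenioid.toElem (arithDivisorFunctor F₂ K₂) (unitsFunctor F₂ K₂)
            (divNatTrans F₂ K₂)))).carrier (ΨBase.functor.obj X))

include hspan in
/-- **Thm. 6.4 (ii) at the `D`-level, for THE realified arithmetic Frobenioids.** An isomorphism of realified divisor
monoids `Φ₁^rlf ⥲ Φ₂^rlf` over an equivalence `Ψ^Base : D₁ ⥲ D₂` (Cor. 4.11 (iii) / Cor. 5.4 data, binder `Erlf`)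
carrying `ℝ · Φ₁^birat` onto `ℝ · Φ₂^birat` (binder `hspan`, the conclusion of `FrdI.Cor54Sub.RealSpanCompat`) induces
isomorphisms `π_X : Pic_Φ(Spec L) ⥲ Pic_Φ(Ψ^Base(Spec L))` ("arises from an isomorphism of monoids": `π_X [a] = [Ψ^Φ a]`),
natural along pull-backs, and there is ONE `deg ∈ ℝ_{>0}` with `δ ∘ π_X = deg · δ` for every `X` — order-compatibility
(the cones are the classes of the monoids) gives `deg_X > 0` by T64ii/L03, and `deg_X = deg_Y` along every `f : X → Y`
because pull-back multiplies BOTH degrees by `[L_X : L_Y] = [L_{Ψ X} : L_{Ψ Y}]` (abc-iut-L1-t12's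
`FinSubextCat.finrank_along_map_eq_of_equivalence`); every `X` maps to `Spec F₁`.
[cite: MochizukiFrdI2008, Thm. 6.4 (ii) p.114] -/
theorem exists_pic_transport_deg [IsGalois F₁ K₁] [IsGalois F₂ K₂] :
    ∃ (π : ∀ X : FinSubextCat F₁ K₁,
        ((RealificationData.canonical (arithDivisorFunctor F₁ K₁) (PreFrobenioid.IsPerfFactorialOn.op hΦ₁)).realSpan
            (PreFrobenioid.biratSubfunctor (ModelFrobenioid.toElem (arithDivisorFunctor F₁ K₁) (unitsFunctor F₁ K₁)
              (divNatTrans F₁ K₁)))).Pic X ≃*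
          ((RealificationData.canonical (arithDivisorFunctor F₂ K₂) (PreFrobenioid.IsPerfFactorialOn.op hΦ₂)).realSpan
            (PreFrobenioid.biratSubfunctor (ModelFrobenioid.toElem (arithDivisorFunctor F₂ K₂) (unitsFunctor F₂ K₂)
              (divNatTrans F₂ K₂)))).Pic (ΨBase.functor.obj X)) (deg : ℝ),
      0 < deg ∧
      (∀ (X : FinSubextCat F₁ K₁) (a : (RealificationData.canonical (arithDivisorFunctor F₁ K₁)
          (PreFrobenioid.IsPerfFactorialOn.op hΦ₁)).rlf.obj (op X)),
          π X (QuotientGroup.mk' _ (Algebra.GrothendieckGroup.of a)) =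
            QuotientGroup.mk' _ (Algebra.GrothendieckGroup.of (Erlf.iso X a))) ∧
      (∀ (X : FinSubextCat F₁ K₁) (c : Algebra.GrothendieckGroup ((RealificationData.canonical
          (arithDivisorFunctor F₁ K₁) (PreFrobenioid.IsPerfFactorialOn.op hΦ₁)).rlf.obj (op X))),
          π X (QuotientGroup.mk' _ c) = QuotientGroup.mk' _ (MonGp.map (Erlf.iso X).toMonoidHom c)) ∧
      (∀ ⦃X Y : FinSubextCat F₁ K₁⦄ (f : Y ⟶ X) (x),
          π Y (((RealificationData.canonical (arithDivisorFunctor F₁ K₁) (PreFrobenioid.IsPerfFactorialOn.op hΦ₁)).realSpan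
            (PreFrobenioid.biratSubfunctor (ModelFrobenioid.toElem (arithDivisorFunctor F₁ K₁) (unitsFunctor F₁ K₁)
              (divNatTrans F₁ K₁)))).picPull f x) =
          ((RealificationData.canonical (arithDivisorFunctor F₂ K₂) (PreFrobenioid.IsPerfFactorialOn.op hΦ₂)).realSpan
            (PreFrobenioid.biratSubfunctor (ModelFrobenioid.toElem (arithDivisorFunctor F₂ K₂) (unitsFunctor F₂ K₂)
              (divNatTrans F₂ K₂)))).picPull (ΨBase.functor.map f) (π X x)) ∧
      ∀ (X : FinSubextCat F₁ K₁) (x),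
        Multiplicative.toAdd (picDegree hΦ₂ (ΨBase.functor.obj X) (π X x)) =
          deg * Multiplicative.toAdd (picDegree hΦ₁ X x) := by
  obtain ⟨π, hcl, hgp, hnat⟩ := GpSubfunctor.exists_pic_mulEquiv_classMap
    ((RealificationData.canonical (arithDivisorFunctor F₁ K₁) (PreFrobenioid.IsPerfFactorialOn.op hΦ₁)).realSpan
      (PreFrobenioid.biratSubfunctor (ModelFrobenioid.toElem (arithDivisorFunctor F₁ K₁) (unitsFunctor F₁ K₁)
        (divNatTrans F₁ K₁))))
    ((RealificationData.canonical (arithDivisorFunctor F₂ K₂) (PreFrobenioid.IsPerfFactorialOn.op hΦ₂)).realSpan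
      (PreFrobenioid.biratSubfunctor (ModelFrobenioid.toElem (arithDivisorFunctor F₂ K₂) (unitsFunctor F₂ K₂)
        (divNatTrans F₂ K₂))))
    ΨBase.functor (fun X => Erlf.iso X) (fun X Y f x => Erlf.natural f x) hspan
  -- STEP 1 (T64ii/L01 ⟹ L02 ⟹ L03): for every `X`, `δ ∘ π_X ∘ δ⁻¹` is monotone, hence `= deg_X · id`, `deg_X > 0`
  have key : ∀ X : FinSubextCat F₁ K₁, ∃ c : ℝ, 0 < c ∧ ∀ x,
      Multiplicative.toAdd (picDegree hΦ₂ (ΨBase.functor.obj X) (π X x)) =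
        c * Multiplicative.toAdd (picDegree hΦ₁ X x) := by
    intro X
    -- the composite `φ_X : ℝ ≃ Pic₁(X) ≃ Pic₂(Ψ X) ≃ ℝ`
    let φ : ℝ ≃+ ℝ :=
      ((picDegreeAddEquiv hΦ₁ X).symm.trans (MulEquiv.toAdditive (π X))).trans (picDegreeAddEquiv hΦ₂ (ΨBase.functor.obj X))
    have hφ : ∀ t, φ t = picDegreeAddEquiv hΦ₂ (ΨBase.functor.obj X)
        (MulEquiv.toAdditive (π X) ((picDegreeAddEquiv hΦ₁ X).symm t)) := fun _ => rfl
    have hmono : Monotone φ := by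
      refine (monotone_of_map_nonneg (picDegreeAddEquiv hΦ₁ X) (picDegreeAddEquiv hΦ₂ (ΨBase.functor.obj X))
        (MulEquiv.toAdditive (π X)) fun z hz => ?_)
      -- `z = [a]` with `a ∈ Φ₁(L)^rlf`, so `π z = [Ψ^Φ a]` has non-negative degree
      have hz' : 0 ≤ Multiplicative.toAdd (picDegree hΦ₁ X (Additive.toMul z)) := hz
      obtain ⟨a, ha⟩ := (picDegree_nonneg_iff hΦ₁ X _).mp hz'
      have h1 : π X (Additive.toMul z) = QuotientGroup.mk' _ (Algebra.GrothendieckGroup.of (Erlf.iso X a)) :=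
        (congrArg (π X) ha).trans (hcl X a)
      show 0 ≤ Multiplicative.toAdd (picDegree hΦ₂ (ΨBase.functor.obj X) (π X (Additive.toMul z)))
      rw [h1]
      exact picDegree_mk_of_nonneg hΦ₂ _ _
    obtain ⟨c, hc, hcφ⟩ := Thm64ii_L03_monotoneAddAut_holds φ hmono
    refine ⟨c, hc, fun x => ?_⟩
    have h := hcφ (Multiplicative.toAdd (picDegree hΦ₁ X x))
    rw [hφ] at h
    have hx : (picDegreeAddEquiv hΦ₁ X).symm (Multiplicative.toAdd (picDegree hΦ₁ X x)) = Additive.ofMul x := by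
      rw [AddEquiv.symm_apply_eq]; rfl
    rw [hx] at h
    exact h
  choose c hc0 hc using key
  -- STEP 2 (T64ii/L04): `deg_Y = deg_X` along every `f : Y ⟶ X`, by naturality of `π` and E3/E4
  have unif : ∀ ⦃X Y : FinSubextCat F₁ K₁⦄ (f : Y ⟶ X), c Y = c X := by
    intro X Y f
    -- a class of degree `1` over `X`
    obtain ⟨x₀, hx₀⟩ := (picDegree_bijective hΦ₁ X).2 (Multiplicative.ofAdd 1)
    have hx₀' : Multiplicative.toAdd (picDegree hΦ₁ X x₀) = 1 := by rw [hx₀, toAdd_ofAdd]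
    -- degree of `π_Y (Pic(f) x₀)` computed in two ways
    have hL := hc Y (((RealificationData.canonical (arithDivisorFunctor F₁ K₁)
      (PreFrobenioid.IsPerfFactorialOn.op hΦ₁)).realSpan (PreFrobenioid.biratSubfunctor
        (ModelFrobenioid.toElem (arithDivisorFunctor F₁ K₁) (unitsFunctor F₁ K₁) (divNatTrans F₁ K₁)))).picPull f x₀)
    rw [toAdd_picDegree_picPull hΦ₁ f x₀, hx₀', mul_one, hnat f x₀, toAdd_picDegree_picPull hΦ₂ (ΨBase.functor.map f),
      hc X x₀, hx₀', mul_one, FinSubextCat.finrank_along_map_eq_of_equivalence ΨBase f] at hL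
    -- the common factor `[L_Y : L_X] ≠ 0`
    have hn : ((letI := f.toAlgHom.toRingHom.toAlgebra; Module.finrank X.L Y.L : ℕ) : ℝ) ≠ 0 := by
      have htower := FinSubextCat.finrank_eq_finrank_mul_finrank_along f
      have hpos : 0 < Module.finrank F₁ Y.L := Module.finrank_pos
      intro h0
      have h0' : (letI := f.toAlgHom.toRingHom.toAlgebra; Module.finrank X.L Y.L : ℕ) = 0 := by exact_mod_cast h0
      rw [h0', mul_zero] at htower
      omega
    exact mul_left_cancel₀ hn ((mul_comm _ _).trans hL.symm)
  -- STEP 3: every `X` maps to `Spec F₁`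
  refine ⟨π, c (FinSubextCat.mk (F := F₁) (K := K₁) ⊥), hc0 _, hcl, hgp, hnat, fun X x => ?_⟩
  rw [hc X x, unif (X := FinSubextCat.mk (F := F₁) (K := K₁) ⊥) (Y := X) ⟨IntermediateField.inclusion bot_le⟩]

end TwoSides

end ArithRlfPic

/-! ### The schema letter `Thm64ii` at THE data -/

namespace ArithFrd

variable {F₁ : Type} [Field F₁] [NumberField F₁] {K₁ : Type} [Field K₁] [Algebra F₁ K₁]
  {F₂ : Type} [Field F₂] [NumberField F₂] {K₂ : Type} [Field K₂] [Algebra F₂ K₂]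
  (hΦ₁ : PreFrobenioid.IsPerfFactorialOn (arithDivisorFunctor F₁ K₁))
  (hΦ₂ : PreFrobenioid.IsPerfFactorialOn (arithDivisorFunctor F₂ K₂))
  (Ψ : PreFrobenioid.rlf (ModelFrobenioid.toElem (arithDivisorFunctor F₁ K₁) (unitsFunctor F₁ K₁) (divNatTrans F₁ K₁)) hΦ₁ ≌
    PreFrobenioid.rlf (ModelFrobenioid.toElem (arithDivisorFunctor F₂ K₂) (unitsFunctor F₂ K₂) (divNatTrans F₂ K₂)) hΦ₂)
  (ΨBase : FinSubextCat F₁ K₁ ≌ FinSubextCat F₂ K₂)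
  (η : Ψ.functor ⋙ (FrdI.Cor54Sub.rlfData (ModelFrobenioid.toElem (arithDivisorFunctor F₂ K₂) (unitsFunctor F₂ K₂)
      (divNatTrans F₂ K₂)) hΦ₂).base ≅
    (FrdI.Cor54Sub.rlfData (ModelFrobenioid.toElem (arithDivisorFunctor F₁ K₁) (unitsFunctor F₁ K₁)
      (divNatTrans F₁ K₁)) hΦ₁).base ⋙ ΨBase.functor)
  (Erlf : PreFrobenioidData.DivisorMonoidIsoOverBase
    (FrdI.Cor54Sub.rlfData (ModelFrobenioid.toElem (arithDivisorFunctor F₁ K₁) (unitsFunctor F₁ K₁)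
      (divNatTrans F₁ K₁)) hΦ₁)
    (FrdI.Cor54Sub.rlfData (ModelFrobenioid.toElem (arithDivisorFunctor F₂ K₂) (unitsFunctor F₂ K₂)
      (divNatTrans F₂ K₂)) hΦ₂) ΨBase.functor)
  (hspan : ∀ X : FinSubextCat F₁ K₁,
    (((RealificationData.canonical (arithDivisorFunctor F₁ K₁) (PreFrobenioid.IsPerfFactorialOn.op hΦ₁)).realSpan
          (PreFrobenioid.biratSubfunctor (ModelFrobenioid.toElem (arithDivisorFunctor F₁ K₁) (unitsFunctor F₁ K₁)
            (divNatTrans F₁ K₁)))).carrier X).map (MonGp.map (Erlf.iso X).toMonoidHom) =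
      ((RealificationData.canonical (arithDivisorFunctor F₂ K₂) (PreFrobenioid.IsPerfFactorialOn.op hΦ₂)).realSpan
          (PreFrobenioid.biratSubfunctor (ModelFrobenioid.toElem (arithDivisorFunctor F₂ K₂) (unitsFunctor F₂ K₂)
            (divNatTrans F₂ K₂)))).carrier (ΨBase.functor.obj X))

include η hspan in
/-- **[FrdI] Theorem 6.4 (ii) AT THE DATA, with THE induced `picMap`.** For THE realified arithmetic Frobenioids
`C_{K_i/F_i}^rlf` with THE `Pic_Φ`, `δ_A` (abc-iut-L1-d2's `arithRealification hΦ_i`), an equivalence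
`Ψ : C₁^rlf ⥲ C₂^rlf` lying over an equivalence `Ψ^Base : D₁ ⥲ D₂` (binder `η`) together with an isomorphism of
realified divisor monoids `Ψ^Φ : Φ₁^rlf ⥲ Φ₂^rlf` over `Ψ^Base` carrying `ℝ · Φ₁^birat` onto `ℝ · Φ₂^birat`
(binders `Erlf`, `hspan`: the data of Cor. 4.11 (iii) / Cor. 5.4 for `Ψ`): the isomorphisms
`picMap_A : Pic_Φ(A) ⥲ Pic_Φ(Ψ A)` "induced by `Ψ^rlf`" — `[a] ↦ (η_A)^*[Ψ^Φ a]` — satisfy `Thm64ii`: there is ONE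
`deg(Ψ^rlf) ∈ ℝ_{>0}` with `δ_{Ψ A} ∘ picMap_A = deg(Ψ^rlf) · δ_A` for every Frobenius-trivial `A`; the second and
third conjuncts identify `picMap` on classes of monoid elements and compute `δ_{Ψ A}` of such a class at
`Ψ^Base(Base A)`. [cite: MochizukiFrdI2008, Thm. 6.4 (ii) p.114] -/
theorem exists_picMap_thm64ii [IsGalois F₁ K₁] [IsGalois F₂ K₂] :
    ∃ picMap : ∀ A, (arithRealification hΦ₁).Pic A ≃+ (arithRealification hΦ₂).Pic (Ψ.functor.obj A),
      Thm64ii (arithRealification hΦ₁) (arithRealification hΦ₂) Ψ picMap ∧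
      (∀ (A : PreFrobenioid.rlf (ModelFrobenioid.toElem (arithDivisorFunctor F₁ K₁) (unitsFunctor F₁ K₁)
          (divNatTrans F₁ K₁)) hΦ₁)
          (x : (RealificationData.canonical (arithDivisorFunctor F₁ K₁) (PreFrobenioid.IsPerfFactorialOn.op hΦ₁)).rlf.obj
            (op A.base)),
          picMap A (Additive.ofMul (QuotientGroup.mk' _ (Algebra.GrothendieckGroup.of x))) =
            Additive.ofMul (((RealificationData.canonical (arithDivisorFunctor F₂ K₂)
              (PreFrobenioid.IsPerfFactorialOn.op hΦ₂)).realSpan (PreFrobenioid.biratSubfunctor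
                (ModelFrobenioid.toElem (arithDivisorFunctor F₂ K₂) (unitsFunctor F₂ K₂) (divNatTrans F₂ K₂)))).picPull
              (X := (Ψ.functor.obj A).base) (Y := ΨBase.functor.obj A.base) (η.hom.app A)
              (QuotientGroup.mk' _ (Algebra.GrothendieckGroup.of (Erlf.iso A.base x))))) ∧
      ∀ (A : PreFrobenioid.rlf (ModelFrobenioid.toElem (arithDivisorFunctor F₁ K₁) (unitsFunctor F₁ K₁)
          (divNatTrans F₁ K₁)) hΦ₁) (hA' : (arithRealification hΦ₂).ops.IsFrobeniusTrivial (Ψ.functor.obj A))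
          (x : (RealificationData.canonical (arithDivisorFunctor F₁ K₁) (PreFrobenioid.IsPerfFactorialOn.op hΦ₁)).rlf.obj
            (op A.base)),
        (arithRealification hΦ₂).δ (Ψ.functor.obj A) hA'
            (picMap A (Additive.ofMul (QuotientGroup.mk' _ (Algebra.GrothendieckGroup.of x)))) =
          Multiplicative.toAdd (ArithRlfPic.picDegree hΦ₂ (ΨBase.functor.obj A.base)
            (QuotientGroup.mk' _ (Algebra.GrothendieckGroup.of (Erlf.iso A.base x)))) := by
  obtain ⟨π, deg, hdeg, hcl, -, -, hπdeg⟩ := ArithRlfPic.exists_pic_transport_deg hΦ₁ hΦ₂ ΨBase Erlf hspan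
  -- the transports `(η_A)^* : Pic(Ψ^Base(Base A)) ⥲ Pic(Base(Ψ A))` along the isomorphisms `η_A`
  let Pb₂ := (RealificationData.canonical (arithDivisorFunctor F₂ K₂) (PreFrobenioid.IsPerfFactorialOn.op hΦ₂)).realSpan
    (PreFrobenioid.biratSubfunctor (ModelFrobenioid.toElem (arithDivisorFunctor F₂ K₂) (unitsFunctor F₂ K₂)
      (divNatTrans F₂ K₂)))
  let i : ∀ A : PreFrobenioid.rlf (ModelFrobenioid.toElem (arithDivisorFunctor F₁ K₁) (unitsFunctor F₁ K₁)
      (divNatTrans F₁ K₁)) hΦ₁, ((Ψ.functor.obj A).base ≅ ΨBase.functor.obj A.base) := fun A => η.app A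
  let τ : ∀ A : PreFrobenioid.rlf (ModelFrobenioid.toElem (arithDivisorFunctor F₁ K₁) (unitsFunctor F₁ K₁)
      (divNatTrans F₁ K₁)) hΦ₁,
      Pb₂.Pic (ΨBase.functor.obj A.base) ≃* Pb₂.Pic (Ψ.functor.obj A).base := fun A =>
    MonoidHom.toMulEquiv (Pb₂.picPull (i A).hom) (Pb₂.picPull (i A).inv)
      (GpSubfunctor.picPull_inv_comp_hom Pb₂ (i A)) (GpSubfunctor.picPull_hom_comp_inv Pb₂ (i A))
  have hτ : ∀ A y, τ A y = Pb₂.picPull (i A).hom y := fun _ _ => rfl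
  refine ⟨fun A => MulEquiv.toAdditive ((π A.base).trans (τ A)), ⟨deg, hdeg, fun A hA hA' x => ?_⟩,
    fun A x => ?_, fun A hA' x => ?_⟩
  · -- `δ_{Ψ A} (picMap_A x) = δ_{Ψ^Base(Base A)} (π x) = deg · δ_A x`
    show Multiplicative.toAdd (ArithRlfPic.picDegree hΦ₂ (Ψ.functor.obj A).base (τ A (π A.base (Additive.toMul x)))) =
      deg * Multiplicative.toAdd (ArithRlfPic.picDegree hΦ₁ A.base (Additive.toMul x))
    rw [hτ, ArithRlfPic.toAdd_picDegree_picPull_iso hΦ₂ (i A), hπdeg]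
  · show Additive.ofMul (τ A (π A.base (QuotientGroup.mk' _ (Algebra.GrothendieckGroup.of x)))) = _
    rw [hcl]
    rfl
  · show Multiplicative.toAdd (ArithRlfPic.picDegree hΦ₂ (Ψ.functor.obj A).base
      (τ A (π A.base (QuotientGroup.mk' _ (Algebra.GrothendieckGroup.of x))))) = _
    rw [hτ, ArithRlfPic.toAdd_picDegree_picPull_iso hΦ₂ (i A), hcl]
    rfl

include η Erlf hspan in
/-- **[FrdI] Theorem 6.4 (ii) AT THE DATA** — the schema letter `Thm64ii` of abc-iut-L1-t3 CLOSED for THE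
`ArithRealification`s `arithRealification hΦ_i` of `C_{K_i/F_i}`, THE equivalence `Ψ` (over `Ψ^Base`, with its
`Ψ^Φ` carrying the real spans) and THE induced `picMap`: "there exists an element `deg(Ψ^rlf) ∈ ℝ_{>0}` … such that
the isomorphism `Pic_Φ(A₁) ⥲ Pic_Φ(A₂)` induced by `Ψ^rlf` is compatible with `δ_{A₁}`, `δ_{A₂}` up to the factor
`deg(Ψ^rlf)`". [cite: MochizukiFrdI2008, Thm. 6.4 (ii) p.114] -/
theorem thm64ii_at_data [IsGalois F₁ K₁] [IsGalois F₂ K₂] :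
    ∃ picMap : ∀ A, (arithRealification hΦ₁).Pic A ≃+ (arithRealification hΦ₂).Pic (Ψ.functor.obj A),
      Thm64ii (arithRealification hΦ₁) (arithRealification hΦ₂) Ψ picMap := by
  obtain ⟨picMap, h, -, -⟩ := exists_picMap_thm64ii hΦ₁ hΦ₂ Ψ ΨBase η Erlf hspan
  exact ⟨picMap, h⟩

end ArithFrd

end Literature.AlgebraicGeometry.Frobenioids

end
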